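import Mathlib
import HarnessLib
import Literature.Probability.LatticeModels.LatticeBootstrapFeasible
import Literature.Probability.LatticeModels.PointwiseScalingLimitEtaExists
import Summits.CriticalPhenomena.Ising3DConformalLimit.Theses.LatticeSDPCertificates
import Summits.CriticalPhenomena.Ising3DConformalLimit.Theorems.LatticeSDPCertificatesCertifiedWindowOneStep
import Summits.CriticalPhenomena.Ising3DConformalLimit.Theorems.LatticeSDPCertificatesCertifiedWindowGlue
import Summits.CriticalPhenomena.Ising3DConformalLimit.Theorems.LatticeSDPCertificatesCertifiedWindowTopPair
import Summits.CriticalPhenomena.Ising3DConformalLimit.Theorems.LatticeSDPCertificatesCertifiedWindowHeatBathRows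
import Summits.CriticalPhenomena.Ising3DConformalLimit.Theorems.LatticeSDPCertificatesCertifiedWindowMomentPositivity

/-!
# Skeleton (rev 5b, lead c3) for crux `CertifiedWindow` (item stmt-CriticalPhenomena-5504)
# of route `LatticeSDPCertificates`, sub-problem `Ising3DConformalLimit` — line `registered` (= `Lines/birth.lean`)

Reading (b) of the route header's TWO-LAYER PLAN, typed: `CW ⇐ BulkWindow ⊕ BoundaryStability`.
Revs 2–3b (lead c2) reduced the crux to ONE inequality per level (`certifiedWindow_iff_topPair`,
all composition pieces landed: OneStep p145628, Glue p145746, TopPair p145983) and left exactly two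
`sorry`s: `stub_bulkWindow` (= item `WindowBelowHalf` 5507, open problem) and
`stub_boundaryScaleStability` (sub-polynomial stability of one scale factor for row-feasible
boundary-law functionals at relative depth `k`; open in print).

**Rev 4 reshaped the boundary stub into its LP form; rev 5 (this file) = rev 4 with the two
provable row stubs LANDED (wave 1: `stub_heatBathRows` p149047, `stub_momentPositivity`
p148985) and used by their landed names, so exactly two `sorry`s remain (STUB 1 = item 5507,
STUB 4 = the LP certificate statement).** The crux text says a level-`kR`
certificate is "spin-flip rows + positivity + the rows above"; the rows above are
`LatticeBootstrapFeasible`, and the two remaining row families, which EVERY boundary-law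
functional `E = boundaryLawFunctional 3 L β_c ν` satisfies automatically, are now typed and
became PROVABLE stubs, now landed:

* `stub_heatBathRows` — the one-site heat-bath (Schwinger–Dyson / spin-flip, Cho–Sun 2023
  Def. 11) identities in coefficient-free pattern form: for `x ∈ Λ_L`, a sign pattern `τ` and a
  finite `B ∌ x`,
  `Σ_{S ⊆ N(x)} τ_S E({x} ∪ (B ∆ S)) = tanh(β_c Σ_{y ∈ N(x)} τ_y) · Σ_{S ⊆ N(x)} τ_S E(B ∆ S)`
  (finite volume: `isingExpect_spinAt_mul_eq_tanh` with `g = σ_B ∏_{y∼x}(1 + τ_y σ_y)`,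
  then integrate `dν`);
* `stub_momentPositivity` — positivity of the underlying law: `0 ≤ Σ_{A ⊆ D} σ_A E(A)` for every
  finite `D` and every `σ` (`Σ_A σ_A s_A = ∏_{y∈D}(1 + σ_y s_y) ≥ 0` under `∫∫ dγ dν`).

The open remainder is ONE `ν`-free statement about ABSTRACT level-`L` functionals,
`stub_boundaryScaleStabilityLP`: normalisation + moment positivity + heat-bath rows +
`LatticeBootstrapFeasible L cw Cw E` at `L ≥ kR` ⇒ `G(qn) E{0,n e₁} ≤ K q^δ G(n) E{0,qn e₁}`
(`qn ≤ R`) — literally the `R`-uniform level-`kR` LP certificate for one-scale-factor ratio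
stability against the bulk `G = criticalTwoPoint 3`. It implies the rev-3 `ν`-form
(`boundaryScaleStability_of_LP` below, sorry-free given the two row stubs) and is implied by the
`ν`-form at relative depth `k+1` (an abstract `E` with these rows, restricted to `Λ_{L-1}`, IS a
level-`(L-1)` boundary-law functional: Walsh inversion + one-site DLR on `Λ_{L-1}` ⇒ `ρ = ρ γ_{Λ_{L-1}}`,
Georgii 2011 Thm. 1.33), so the reshape loses nothing.

Stubs: `stub_bulkWindow` (research, = 5507), `stub_boundaryScaleStabilityLP` (research, held by
the lead); LANDED: `stub_heatBathRows` (p149047), `stub_momentPositivity` (p148985).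
`CertifiedWindow_of` concludes the route decl BY NAME with no hypotheses and no `sorry` of its own.

Rev 5b (doc only; cycles 2–3 of lead c3) — what is now LANDED around STUB 4:
* it is TRUE QUALITATIVELY: with the relative depth `k = k(R)` allowed to depend on `R`, for ALL
  probability boundary laws and with constant `1 + δ` (`scaleStability_nonuniform`,
  `window_at_depth_of_windowBelowHalf` — `WindowBelowHalf` alone gives CW's conclusion at every
  `R` with uniform `(ε, c)` and `k = k(R)`; file `Theorems/…CertifiedWindowQualitativeStability.lean`,
  p151338, from the Literature uniform limit `boundaryLawFunctional_criticalBeta_pair_sub_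
  criticalTwoPoint_uniform`, p150391, i.e. uniqueness of the critical state, `m*(β_c) = 0`).
  So the ENTIRE open content of STUB 4 is a RATE (boundedness of `k(R)` over row-feasible laws);
  the upper side of boundary influence is the plus magnetisation squared
  (`boundaryLaw_pair_le_bulk_add_magnetization`, GHS), the open side is the lower one;
* the LP reshape is LOSSLESS: `lpForm_of_nuForm` (file `…CertifiedWindowLPCompleteness.lean`,
  with `exists_boundaryLaw_of_rows`: an abstract `E` with normalisation, moment positivity and the
  heat-bath rows IS a level-`(L-1)` boundary-law functional — Walsh inversion p152189, rows ⇒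
  detailed balance p152494, balance ⇒ Gibbs-kernel invariance p152658, feasibility transfer
  `LatticeBootstrapFeasible.congr` p151890) and `boundaryScaleStability_of_LP` below give
  `ν`-form(k) ⇒ LP-form(k+1) ⇒ `ν`-form(k+1).
-/

namespace Summit.CriticalPhenomena.Ising3DConformalLimit.Cruxes.CertifiedWindow.Birth

/-- **STUB 1 (research; bulk WINDOW = item `WindowBelowHalf`, stmt-CriticalPhenomena-5507).**
`c (n/m)^{-(3/2-ε)} G(m e₁) ≤ G(n e₁)`, `1 ≤ m ≤ n`, `G = criticalTwoPoint 3`. Open problem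
(η_eff < 1/2 at every scale; ADC21 Rem. 5.10; DCP25 Thm 1.5 gives only η ≤ 1/2 if η exists). -/
theorem stub_bulkWindow : ∃ ε c : ℝ, 0 < ε ∧ 0 < c ∧ ∀ m n : ℕ, 1 ≤ m → m ≤ n → c * ((n : ℝ) / m) ^ (-((3:ℝ) / 2 - ε)) * Literature.Probability.LatticeModels.criticalTwoPoint 3 (Pi.single 0 (m : ℤ)) ≤ Literature.Probability.LatticeModels.criticalTwoPoint 3 (Pi.single 0 (n : ℤ)) := by
  sorry

/-! STUB 2 `stub_heatBathRows` (one-site heat-bath / spin-flip rows of a boundary-law functional,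
pattern form) is LANDED: `Summit.CriticalPhenomena.Ising3DConformalLimit.Theorems.stub_heatBathRows`
(file `Theorems/LatticeSDPCertificatesCertifiedWindowHeatBathRows.lean`, p149047, commit 684a64f0d96c;
general versions `isingCorr_fixed_heatBath_rows`, `boundaryLawFunctional_heatBath_rows`).
STUB 3 `stub_momentPositivity` (`0 ≤ Σ_{A⊆D} σ_A E(A)`) is LANDED:
`Summit.CriticalPhenomena.Ising3DConformalLimit.Theorems.stub_momentPositivity`
(file `Theorems/LatticeSDPCertificatesCertifiedWindowMomentPositivity.lean`, p148985, commit 0afd48bef7f1).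
Both are used below by their landed names. -/

/-- **STUB 4 (research, rev 4; the LP form of boundary-law scale stability).** For all
`cw, Cw > 0`, `δ > 0` there is `K > 0` such that for every `q ≥ 2` there is `k ≥ 1` with: for all
`L ≥ k R` and every ABSTRACT functional `E : Finset (Site 3) → ℝ` that is normalised (`E ∅ = 1`),
moment-positive (`0 ≤ Σ_{A⊆D} σ_A E(A)`), satisfies the heat-bath rows at every `x ∈ Λ_L` and the
lattice-bootstrap rows `LatticeBootstrapFeasible L cw Cw E`, and all `n ≥ 1` with `q n ≤ R`:
`G(q n e₁) E{0,n e₁} ≤ K q^δ G(n e₁) E{0,q n e₁}` (`G = criticalTwoPoint 3`). This is the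
`R`-uniform level-`kR` LP certificate of the crux text ("spin-flip rows + positivity + the rows
above") for one-scale-factor ratio stability against the bulk; identity with `K = 1` on the bulk
functional; TRUE with `k = k(R)` (`scaleStability_nonuniform` + `lpForm_of_nuForm`, landed);
equivalent (up to `k ↦ k+1`) to the `ν`-form `stub_boundaryScaleStability` of rev 3. Why open:
the `R`-uniform RATE — no critical boundary-influence / ratio-mixing rate on `ℤ³` is known
(FawziFawzi2025 Thm 2.4 only `β < β_c`; ChoSun2023 §6 no rate; ADS15 uniqueness is
qualitative). Size: XL / open. -/
theorem stub_boundaryScaleStabilityLP : ∀ cw Cw : ℝ, 0 < cw → 0 < Cw → ∀ δ : ℝ, 0 < δ → ∃ K : ℝ, 0 < K ∧ ∀ q : ℕ, 2 ≤ q → ∃ k : ℕ, 1 ≤ k ∧ ∀ (L R : ℕ) (E : Finset (Literature.Probability.LatticeModels.Site 3) → ℝ), k * R ≤ L → E ∅ = 1 → (∀ (D : Finset (Literature.Probability.LatticeModels.Site 3)) (σ : Literature.Probability.LatticeModels.SpinConfig (Literature.Probability.LatticeModels.Site 3)), 0 ≤ ∑ A ∈ D.powerset, Literature.Probability.LatticeModels.spinProduct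 A σ * E A) → (∀ x : Literature.Probability.LatticeModels.Site 3, x ∈ Literature.Probability.LatticeModels.box 3 L → ∀ (τ : Literature.Probability.LatticeModels.SpinConfig (Literature.Probability.LatticeModels.Site 3)) (B : Finset (Literature.Probability.LatticeModels.Site 3)), x ∉ B → ∑ S ∈ ((Literature.Probability.LatticeModels.zdGraph 3).neighborFinset x).powerset, Literature.Probability.LatticeModels.spinProduct S τ * E (insert x (symmDiff B S)) = Real.tanh (Literature.Probability.LatticeModels.criticalBeta 3 * ∑ y ∈ (Literature.Probability.LatticeModels.zdGraph 3).neighborFinset x, Literature.Probability.LatticeModels.spinAt y τ) * ∑ S ∈ ((Literature.Probability.LatticeModels.zdGraph 3).neighborFinset x).powerset, Literature.Probability.LatticeModels.spinProduct S τ * E (symmDiff B S)) → Literature.Probability.LatticeModels.LatticeBootstrapFeasible L cw Cw E → ∀ n : ℕ, 1 ≤ n → q * n ≤ R → Literature.Probability.LatticeModels.criticalTwoPoint 3 (Pi.single 0 ((q * n : ℕ) : ℤ)) * E {0, Pi.single 0 (n : ℤ)} ≤ K * (q : ℝ) ^ δ * Literature.Probability.LatticeModels.criticalTwoPoint 3 (Pi.single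 0 (n : ℤ)) * E {0, Pi.single 0 ((q * n : ℕ) : ℤ)} := by
  sorry

/-! STUB `stub_oneStepCriterion`, `stub_glueToOneStep`, `stub_topPairCriterion` of revs 2–3 are
LANDED (`Theorems/LatticeSDPCertificatesCertifiedWindow{OneStep,Glue,TopPair}.lean`,
p145628 / p145746 / p145983) and are used below by their landed names. -/

/-- **The LP form gives the `ν`-form (rev-3 `stub_boundaryScaleStability`), sorry-free modulo
STUB 4** (STUBS 2–3 landed): a boundary-law functional is normalised (`boundaryLawFunctional_empty`),
moment-positive (STUB 3) and satisfies the heat-bath rows (STUB 2), so STUB 4 applies to it. -/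
theorem boundaryScaleStability_of_LP : ∀ cw Cw : ℝ, 0 < cw → 0 < Cw → ∀ δ : ℝ, 0 < δ → ∃ K : ℝ, 0 < K ∧ ∀ q : ℕ, 2 ≤ q → ∃ k : ℕ, 1 ≤ k ∧ ∀ (L R : ℕ) (ν : MeasureTheory.Measure (Literature.Probability.LatticeModels.SpinConfig (Literature.Probability.LatticeModels.Site 3))), k * R ≤ L → MeasureTheory.IsProbabilityMeasure ν → Literature.Probability.LatticeModels.LatticeBootstrapFeasible L cw Cw (Literature.Probability.LatticeModels.boundaryLawFunctional 3 L (Literature.Probability.LatticeModels.criticalBeta 3) ν) → ∀ n : ℕ, 1 ≤ n → q * n ≤ R → Literature.Probability.LatticeModels.criticalTwoPoint 3 (Pi.single 0 ((q * n : ℕ) : ℤ)) * Literature.Probability.LatticeModels.boundaryLawFunctional 3 L (Literature.Probability.LatticeModels.criticalBeta 3) ν {0, Pi.single 0 (n : ℤ)} ≤ K * (q : ℝ) ^ δ * Literature.Probability.LatticeModels.criticalTwoPoint 3 (Pi.single 0 (n : ℤ)) * Literature.Probability.LatticeModels.boundaryLawFunctional 3 L (Literature.Probability.LatticeModels.criticalBeta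 3) ν {0, Pi.single 0 ((q * n : ℕ) : ℤ)} := by
  intro cw Cw hcw hCw δ hδ
  obtain ⟨K, hK, hq⟩ := stub_boundaryScaleStabilityLP cw Cw hcw hCw δ hδ
  refine ⟨K, hK, fun q hq2 => ?_⟩
  obtain ⟨k, hk, h⟩ := hq q hq2
  refine ⟨k, hk, fun L R ν hkR hν hfeas n hn hqn => ?_⟩
  haveI := hν
  exact h L R (Literature.Probability.LatticeModels.boundaryLawFunctional 3 L
      (Literature.Probability.LatticeModels.criticalBeta 3) ν) hkR
    (Literature.Probability.LatticeModels.boundaryLawFunctional_empty L _ ν)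
    (Summit.CriticalPhenomena.Ising3DConformalLimit.Theorems.stub_momentPositivity L ν hν)
    (Summit.CriticalPhenomena.Ising3DConformalLimit.Theorems.stub_heatBathRows L ν hν) hfeas n hn hqn

/-- Every pair ⇒ top pair (specialise `n := R`); the trivial direction, sorry-free, used to feed
the landed top-pair criterion from the landed glue. -/
theorem topPair_of_oneStep'
    (h : ∀ cw Cw : ℝ, 0 < cw → 0 < Cw → ∃ (q : ℕ) (κ : ℝ) (k : ℕ), 2 ≤ q ∧
      (q : ℝ) ^ (-((3 : ℝ) / 2)) < κ ∧ q ≤ k ∧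
      ∀ (R : ℕ) (ν : MeasureTheory.Measure (Literature.Probability.LatticeModels.SpinConfig
        (Literature.Probability.LatticeModels.Site 3))), MeasureTheory.IsProbabilityMeasure ν →
        Literature.Probability.LatticeModels.LatticeBootstrapFeasible (k * R) cw Cw
          (Literature.Probability.LatticeModels.boundaryLawFunctional 3 (k * R)
            (Literature.Probability.LatticeModels.criticalBeta 3) ν) →
        ∀ n : ℕ, 1 ≤ n → n ≤ R →
          κ * Literature.Probability.LatticeModels.boundaryLawFunctional 3 (k * R)
              (Literature.Probability.LatticeModels.criticalBeta 3) ν {0, Pi.single 0 (n : ℤ)} ≤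
            Literature.Probability.LatticeModels.boundaryLawFunctional 3 (k * R)
              (Literature.Probability.LatticeModels.criticalBeta 3) ν {0, Pi.single 0 ((q * n : ℕ) : ℤ)}) :
    ∀ cw Cw : ℝ, 0 < cw → 0 < Cw → ∃ (q : ℕ) (κ : ℝ) (k : ℕ), 2 ≤ q ∧
      (q : ℝ) ^ (-((3 : ℝ) / 2)) < κ ∧ q ≤ k ∧
      ∀ (R : ℕ) (ν : MeasureTheory.Measure (Literature.Probability.LatticeModels.SpinConfig
        (Literature.Probability.LatticeModels.Site 3))), MeasureTheory.IsProbabilityMeasure ν →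
        Literature.Probability.LatticeModels.LatticeBootstrapFeasible (k * R) cw Cw
          (Literature.Probability.LatticeModels.boundaryLawFunctional 3 (k * R)
            (Literature.Probability.LatticeModels.criticalBeta 3) ν) → 1 ≤ R →
        κ * Literature.Probability.LatticeModels.boundaryLawFunctional 3 (k * R)
            (Literature.Probability.LatticeModels.criticalBeta 3) ν {0, Pi.single 0 (R : ℤ)} ≤
          Literature.Probability.LatticeModels.boundaryLawFunctional 3 (k * R)
            (Literature.Probability.LatticeModels.criticalBeta 3) ν {0, Pi.single 0 ((q * R : ℕ) : ℤ)} := by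
  intro cw Cw hcw hCw
  obtain ⟨q, κ, k, hq, hqκ, hqk, hR⟩ := h cw Cw hcw hCw
  exact ⟨q, κ, k, hq, hqκ, hqk, fun R ν hν hfeas hR1 => hR R ν hν hfeas R hR1 le_rfl⟩

/-- **REGISTERED SKELETON THEOREM (rev 4)** — concludes the route decl `CertifiedWindow` BY NAME
with no hypotheses and no `sorry` of its own: the landed top-pair criterion applied to the
top-pair form of the one-step hypothesis produced by the landed glue from STUB 1 (bulk) and the
`ν`-form of boundary scale stability, itself obtained from STUBS 2–4 (`boundaryScaleStability_of_LP`)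
at the loss exponent `ε₁/2` of STUB 1. -/
theorem CertifiedWindow_of : Summit.CriticalPhenomena.Ising3DConformalLimit.Theses.LatticeSDPCertificates.CertifiedWindow := by
  obtain ⟨ε₁, c₁, hε₁, hc₁, hwin⟩ := stub_bulkWindow
  exact Summit.CriticalPhenomena.Ising3DConformalLimit.Theorems.stub_topPairCriterion (topPair_of_oneStep'
    (Summit.CriticalPhenomena.Ising3DConformalLimit.Theorems.stub_glueToOneStep ε₁ c₁ hε₁ hc₁ hwin
      (fun cw Cw hcw hCw => boundaryScaleStability_of_LP cw Cw hcw hCw (ε₁ / 2) (half_pos hε₁))))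

end Summit.CriticalPhenomena.Ising3DConformalLimit.Cruxes.CertifiedWindow.Birth
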